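import Summits.PneNP.PneNP.Theorems.SignDeg2AvoidAffineSplitMachine
import Summits.PneNP.PneNP.Theorems.PstarPairPeel

/-!
# F4-FP, part 1/3: the P⋆ pair-peeling reduction as a machine — hub pairing, derived code, scatter

Cell pnp-ideate, ROUND-18 notes §F4 (`Theorems/PstarPairPeel.lean`, pnp-ideate-p3): for a `4`-local map all of
whose tables are `P⋆ = x₀ ⊕ x₁ ⊕ x₂x₃`, pairs of outputs reading the same XOR slots peel off to an `IP₂` instance
(`PstarPairPeel.peel`), and a point outside the derived range lifts back (`PstarPairPeel.lift_not_mem_range`).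
The support item «`SignDeg2OnlyAvoidLinearFP 4 → ∃ C', LocalAvoidLinearFP 4 (P⋆ instances with a pairing of size
C'·n)`» asks for ONE polynomial-time function doing this; here is the machine `ppStr f₀` (a list program), its
semantics on genuine codes, and the HUB PAIRING it implements:

* every output `j` has a HUB `hub j` = the first output reading the same two XOR slots (`hubOf`, a `findIdx`);
  the non-hub outputs are the first components of the pairs, each paired with its hub (`hubPairing`: a
  `PstarPairPeel.Pairing` — hubs are fixed points, so no first component is a second component);
* the machine rebuilds the code of `peel I hubPairing` (table block of `IP₂`, positions `c_j d_j c_hub d_hub`),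
  runs the hypothesised sign-degree-2 avoider `f₀` on it and scatters the answer to the non-hub outputs
  (`false` on hubs) — which is `PstarPairPeel.lift` (part 2).

Part 2: the hub pairing is a LARGEST pairing (so `C' = C₀` works) and correctness; part 3: `CodeFP` typing and
the support theorem.  Restricted-model reduction step; nothing here bears on `P` versus `NP`.
-/

set_option linter.dupNamespace false -- `Summit.PneNP.PneNP.…`: summit = sub-problem name (D-0017 single-conjunct layout)

namespace Summit.PneNP.PneNP.Theorems.PstarPairPeelFP

open Literature.Computability.Complexity
open Summit.PneNP.PneNP.Theorems.MajLocalAvoidFP (rowOf length_rowOf getD_rowOf)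
open Summit.PneNP.PneNP.Theorems.LocalMapDecodeFP (tabOf blockOf encode_eq decode outsOf decode_encode hdrN hdrN_encode)
open Summit.PneNP.PneNP.Theorems.AffineSplitFP (blk blk_out getD_map_finRange)
open Summit.PneNP.PneNP.Theorems.PstarPairPeel (Pairing peel lift)

variable {n m : ℕ}

/-! ## The program -/

/-- The XOR SLOTS of a row of positions: its first two entries (indices written as `Fin 4` values). -/
def key (r : List ℕ) : ℕ × ℕ := (r.getD (0 : Fin 4).val 0, r.getD (1 : Fin 4).val 0)

/-- The HUB of output `j`: the first output reading the same XOR slots. -/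
def hubOf (rows : List (List ℕ)) (j : ℕ) : ℕ := rows.findIdx fun r => key r == key (rows.getD j [])

/-- The non-hub outputs, increasing: the first components of the pairs. -/
def fsts (rows : List (List ℕ)) : List ℕ := (List.range rows.length).filter fun j => !(hubOf rows j == j)

/-- The `16` table bits of `IP₂` (the table block of every derived output). -/
def ipTab : List Bool := List.ofFn fun p : Fin (2 ^ 4) => ipPred₂ fun i : Fin 4 => p.val.testBit i.val

/-- The derived output of a non-hub output `j`, decoded: table `IP₂`, positions `c_j d_j c_hub d_hub`. -/
def peelOut (rows : List (List ℕ)) (j : ℕ) : List Bool × List ℕ :=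
  (ipTab, [(rows.getD j []).getD (2 : Fin 4).val 0, (rows.getD j []).getD (3 : Fin 4).val 0,
    (rows.getD (hubOf rows j) []).getD (2 : Fin 4).val 0, (rows.getD (hubOf rows j) []).getD (3 : Fin 4).val 0])

/-- The code of the derived instance on the same `N` inputs (blocks rebuilt with `AffineSplitFP.blk`). -/
def peelCode (N : ℕ) (rows : List (List ℕ)) : List Bool :=
  LocalMap.unaryCode N ++ LocalMap.unaryCode (fsts rows).length ++ ((fsts rows).map fun j => blk N (peelOut rows j)).flatten

/-- The printed bits: `f₀`'s answer on the derived code scattered to the non-hub outputs, `false` on hubs. -/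
def outP (f₀ : List Bool → List Bool) (N : ℕ) (rows : List (List ℕ)) : List Bool :=
  (List.range rows.length).map fun j => !(hubOf rows j == j) && (f₀ (peelCode N rows)).getD ((fsts rows).findIdx (· == j)) false

/-- **THE MACHINE** `ppStr f₀`: decode (locality `4`), keep the position rows, pair, peel, solve, scatter. -/
def ppStr (f₀ : List Bool → List Bool) (w : List Bool) : List Bool := outP f₀ (hdrN w) ((decode 4 w).map Prod.snd)

/-! ## Semantics on the code of an instance: hubs and the hub pairing -/

/-- The position rows of an instance. -/
def rowsOf (I : LocalMap 4 n m) : List (List ℕ) := (List.finRange m).map (rowOf I)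

/-- The decoder delivers the position rows. -/
theorem decode_rows (I : LocalMap 4 n m) : (decode 4 I.encode).map Prod.snd = rowsOf I := by
  rw [decode_encode, outsOf, rowsOf, List.map_map]; rfl

/-- The rows list has `m` entries. -/
@[simp] theorem length_rowsOf (I : LocalMap 4 n m) : (rowsOf I).length = m := by simp [rowsOf]

/-- Row `j` of the rows list. -/
theorem getD_rowsOf (I : LocalMap 4 n m) (j : Fin m) : (rowsOf I).getD j.val [] = rowOf I j := getD_map_finRange _ _ j

/-- The key of row `j` is the pair of XOR slots of output `j`. -/
theorem key_rowOf (I : LocalMap 4 n m) (j : Fin m) : key (rowOf I j) = ((I.vars j 0).val, (I.vars j 1).val) := by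
  unfold key; rw [getD_rowOf I j 0, getD_rowOf I j 1]

/-- The hub of output `j`, as a number. -/
def hubN (I : LocalMap 4 n m) (j : Fin m) : ℕ := hubOf (rowsOf I) j.val

/-- Entry `t` of the rows list. -/
theorem getElem_rowsOf (I : LocalMap 4 n m) (t : ℕ) (ht : t < (rowsOf I).length) :
    (rowsOf I)[t] = rowOf I ⟨t, by simpa using ht⟩ := by
  simp [rowsOf, List.getElem_map, List.getElem_finRange, Fin.cast_mk]

/-- On any row list, the hub of a genuine position comes no later than the position. -/
theorem hubOf_le (rows : List (List ℕ)) (j : ℕ) (hj : j < rows.length) : hubOf rows j ≤ j := by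
  by_contra h
  have h1 := List.not_of_lt_findIdx (xs := rows) (p := fun r => key r == key (rows.getD j [])) (lt_of_not_ge h)
  simp only [List.getD_eq_getElem?_getD, List.getElem?_eq_getElem hj, Option.getD_some, beq_eq_false_iff_ne, ne_eq] at h1
  exact h1 rfl

/-- On any row list, the hub of a genuine position has the same key. -/
theorem key_hubOf (rows : List (List ℕ)) (j : ℕ) (hj : j < rows.length) :
    key (rows[hubOf rows j]'((hubOf_le rows j hj).trans_lt hj)) = key (rows.getD j []) := by
  have hlt : rows.findIdx (fun r => key r == key (rows.getD j [])) < rows.length := (hubOf_le rows j hj).trans_lt hj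
  have h := List.findIdx_getElem (w := hlt)
  simp only [beq_iff_eq] at h
  exact h

/-- The hub comes no later than the output. -/
theorem hubN_le (I : LocalMap 4 n m) (j : Fin m) : hubN I j ≤ j.val := hubOf_le (rowsOf I) j.val (by simp)

/-- The hub is an output. -/
theorem hubN_lt (I : LocalMap 4 n m) (j : Fin m) : hubN I j < m := (hubN_le I j).trans_lt j.isLt

/-- The hub of output `j`. -/
def hub (I : LocalMap 4 n m) (j : Fin m) : Fin m := ⟨hubN I j, hubN_lt I j⟩

/-- **The hub reads the same XOR slots.** -/
theorem key_hub (I : LocalMap 4 n m) (j : Fin m) : key (rowOf I (hub I j)) = key (rowOf I j) := by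
  have h := key_hubOf (rowsOf I) j.val (by simp)
  rw [getElem_rowsOf, getD_rowsOf] at h
  exact h

/-- Outputs with the same XOR slots have the same hub. -/
theorem hubN_eq_of_key_eq (I : LocalMap 4 n m) {j j' : Fin m} (h : key (rowOf I j) = key (rowOf I j')) : hubN I j = hubN I j' := by
  unfold hubN hubOf; rw [getD_rowsOf, getD_rowsOf, h]

/-- **Hubs are fixed points.** -/
theorem hubN_hub (I : LocalMap 4 n m) (j : Fin m) : hubN I (hub I j) = hubN I j := hubN_eq_of_key_eq I (key_hub I j)

/-- The hub shares XOR slot `0`. -/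
theorem vars_hub_zero (I : LocalMap 4 n m) (j : Fin m) : I.vars (hub I j) 0 = I.vars j 0 := by
  have h := key_hub I j; rw [key_rowOf, key_rowOf, Prod.mk.injEq] at h; exact Fin.ext h.1

/-- The hub shares XOR slot `1`. -/
theorem vars_hub_one (I : LocalMap 4 n m) (j : Fin m) : I.vars (hub I j) 1 = I.vars j 1 := by
  have h := key_hub I j; rw [key_rowOf, key_rowOf, Prod.mk.injEq] at h; exact Fin.ext h.2

/-- The non-hub outputs, increasing (the first components of the hub pairing). -/
def fstList (I : LocalMap 4 n m) : List (Fin m) := (List.finRange m).filter fun j => !(hubN I j == j.val)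

/-- The machine's list of first components is the list of non-hub outputs. -/
theorem fsts_rowsOf (I : LocalMap 4 n m) : fsts (rowsOf I) = (fstList I).map Fin.val := by
  unfold fsts fstList hubN
  rw [length_rowsOf, ← List.map_coe_finRange_eq_range, List.filter_map]
  rfl

/-- Members of the list are non-hubs. -/
theorem hubN_ne_of_mem {I : LocalMap 4 n m} {j : Fin m} (h : j ∈ fstList I) : hubN I j ≠ j.val := by
  unfold fstList at h; simpa using (List.mem_filter.1 h).2

/-- The list of non-hub outputs has no duplicates. -/
theorem nodup_fstList (I : LocalMap 4 n m) : (fstList I).Nodup := (List.nodup_finRange m).filter _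

/-- **THE HUB PAIRING**: pair `i` = (the `i`-th non-hub output, its hub). -/
def hubPairing (I : LocalMap 4 n m) : Pairing I (fstList I).length where
  fst i := (fstList I).get i
  snd i := hub I ((fstList I).get i)
  fst_injective := List.nodup_iff_injective_get.1 (nodup_fstList I)
  fst_ne_snd i i' e := by
    have h1 : hubN I ((fstList I).get i) ≠ ((fstList I).get i).val := hubN_ne_of_mem (List.get_mem _ _)
    have h2 : hubN I (hub I ((fstList I).get i')) = (hub I ((fstList I).get i')).val := hubN_hub I _
    rw [← e] at h2
    exact h1 h2
  vars_zero i := (vars_hub_zero I _).symm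
  vars_one i := (vars_hub_one I _).symm

/-! ## Semantics: the derived code and the printed string -/

/-- The table block of every derived output is `ipTab`. -/
theorem tabOf_peel (I : LocalMap 4 n m) (i : Fin (fstList I).length) : tabOf (peel I (hubPairing I)) i = ipTab := rfl

/-- The position row of derived output `i`: `c_j d_j c_hub d_hub` for `j` the `i`-th non-hub output. -/
theorem rowOf_peel (I : LocalMap 4 n m) (i : Fin (fstList I).length) :
    rowOf (peel I (hubPairing I)) i =
      [(I.vars ((fstList I).get i) 2).val, (I.vars ((fstList I).get i) 3).val,
        (I.vars (hub I ((fstList I).get i)) 2).val, (I.vars (hub I ((fstList I).get i)) 3).val] := by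
  simp [rowOf, peel, hubPairing, List.ofFn_succ]

/-- **The machine's derived output `j` is the decoded derived output** of the hub pairing. -/
theorem peelOut_rowsOf (I : LocalMap 4 n m) (i : Fin (fstList I).length) :
    peelOut (rowsOf I) ((fstList I).get i).val = (tabOf (peel I (hubPairing I)) i, rowOf (peel I (hubPairing I)) i) := by
  rw [tabOf_peel, rowOf_peel, peelOut, getD_rowsOf]
  have hh : (rowsOf I).getD (hubOf (rowsOf I) ((fstList I).get i).val) [] = rowOf I (hub I ((fstList I).get i)) :=
    getD_rowsOf I (hub I _)
  rw [hh, getD_rowOf I _ 2, getD_rowOf I _ 3, getD_rowOf I _ 2, getD_rowOf I _ 3]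

/-- **The machine feeds `f₀` the code of the derived instance.** -/
theorem peelCode_rowsOf (I : LocalMap 4 n m) : peelCode n (rowsOf I) = (peel I (hubPairing I)).encode := by
  rw [peelCode, fsts_rowsOf, List.length_map, List.map_map, encode_eq]
  have hb : (fstList I).map ((fun j => blk n (peelOut (rowsOf I) j)) ∘ Fin.val) =
      (List.finRange (fstList I).length).map (blockOf (peel I (hubPairing I))) := by
    calc (fstList I).map ((fun j => blk n (peelOut (rowsOf I) j)) ∘ Fin.val)
        = ((List.finRange (fstList I).length).map (fstList I).get).map ((fun j => blk n (peelOut (rowsOf I) j)) ∘ Fin.val) := by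
          rw [← List.ofFn_eq_map, List.ofFn_get]
      _ = (List.finRange (fstList I).length).map (blockOf (peel I (hubPairing I))) := by
          rw [List.map_map]
          refine List.map_congr_left fun i _ => ?_
          simp only [Function.comp_apply]
          rw [peelOut_rowsOf, blk_out]
  rw [hb]

/-- **What the machine prints on a genuine code**: at a non-hub output, bit «rank among the non-hubs» of `f₀`'s
answer on the derived code; `false` at hubs. -/
theorem readOut_ppStr (f₀ : List Bool → List Bool) (I : LocalMap 4 n m) (j : Fin m) :
    readOut m (ppStr f₀ I.encode) j =
      (!(hubN I j == j.val) && (f₀ (peel I (hubPairing I)).encode).getD (((fstList I).map Fin.val).findIdx (· == j.val)) false) := by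
  unfold readOut ppStr
  rw [hdrN_encode, decode_rows, outP, peelCode_rowsOf, fsts_rowsOf, length_rowsOf, ← List.map_coe_finRange_eq_range,
    List.map_map, getD_map_finRange]
  rfl

end Summit.PneNP.PneNP.Theorems.PstarPairPeelFP
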